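import Summits.SmoothPoincare4.SmoothPoincare4.Theorems.InformationMetricHadamardAhHadamardFillingStubHellingerGaussEquationLpFamily

/-!
# A jointly smooth family over a parameter manifold as a smooth map into `L²`
(crux `InformationMetricHadamard.AhHadamardFilling`, item stmt-SmoothPoincare4-6014, line
`fisher-sphere-gauss`, stub F `stub_instantonCollarPackage` — the Donaldson–Taubes collar of a
model of the instanton moduli space). Stub F needs the Hellinger map of the collar,
`p = (σ, λ) ↦ 2√ρ_{Ψ p} ∈ L²(Σ, dvol)`, as a smooth map on the open collar domain
`s ⊆ Σ × ℝ`, together with its differential `X ↦ [∂_X θ]`, so that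
`‖dθ X‖²_{L²} = ∫ (∂_X θ)² dvol` can be compared with the Groisser–Murray asymptotics. This file
proves the generic statement behind it (`helper_toLp_family_manifold`): for a family
`ρ : M → K → ℝ` jointly `C^∞` on `s × K` (`M` a boundaryless manifold with finite-dimensional
model, `s ⊆ M` open, `K` a compact manifold with a finite Borel measure `μ`) and continuous
representatives `F p ∈ C(K, ℝ)` of `ρ p` (`p ∈ s`), the map `p ↦ [F p] ∈ L²(K, μ)` is `C^∞` on `s`
and its vector-valued manifold derivative along `X ∈ T_p M` is the class of the pointwise
manifold derivative `x ↦ d(ρ · x)_p X` (which is continuous in `x`).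

The normed-parameter case is `contDiffOn_toLp_family` / `hasFDerivAt_toLp_family` of
`…StubHellingerGaussEquationLpFamily.lean` (Dieudonné (8.11.2): differentiation of a family
uniformly over a compact index space, composed with the continuous linear map
`ContinuousMap.toLp`); the 5-manifold case is `contMDiff_toLp_family` / `mvfderiv_toLp_family`
there. Here the chart argument is run over a general boundaryless parameter manifold: in the
extended chart `φ` at `p₀ ∈ s` the map reads `y ↦ [F (φ⁻¹ y)]` on the open set
`φ.target ∩ φ⁻¹⁻¹(s)`, where the chart family `(y, x) ↦ ρ (φ⁻¹ y) x` is jointly smooth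
(`contMDiffOn_chartFamily_manifold`); manifold derivatives of vector-valued maps are read through
the chart by `mfderiv_eq_of_hasFDerivAt_extChartAt` (chain rule and `mfderiv_extChartAt_self`).
Authorship: stub-worker of the line lead prover-line-stmt-SmoothPoincare4-6014-c5-0 (wave 2).

References: J. Dieudonné, *Foundations of Modern Analysis* (1960), (8.11.2); S. Lang, *Real and
Functional Analysis*, XIII §8; D. Groisser, M. K. Murray, dg-ga/9611008, §2–3.
-/

noncomputable section

-- the prescribed namespace `Summit.<P>.<Sub>.…` duplicates `SmoothPoincare4` (P = Sub)
set_option linter.dupNamespace false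

open scoped Manifold ContDiff Topology ENNReal
open Set Function MeasureTheory Topology Filter

namespace Summit.SmoothPoincare4.SmoothPoincare4.Cruxes.AhHadamardFilling.FisherSphereGauss

/-! ## §A. Manifold derivatives of vector-valued maps read through an extended chart -/

section Chart

variable {E : Type*} [NormedAddCommGroup E] [NormedSpace ℝ E] {H : Type*} [TopologicalSpace H]
  {I : ModelWithCorners ℝ E H} {M : Type*} [TopologicalSpace M] [ChartedSpace H M]
  [IsManifold I 1 M] {V : Type*} [NormedAddCommGroup V] [NormedSpace ℝ V]

/-- **The manifold derivative of a vector-valued map through the extended chart.** If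
`f : M → V` agrees near `x` with `Φ ∘ φ_x` (`φ_x` the extended chart at `x`) and `Φ` has Fréchet
derivative `L` at `φ_x x`, then `mfderiv f x v = L v` for every `v ∈ T_x M` (chain rule and
`mfderiv_extChartAt_self`; the model with corners `I` is arbitrary). [folklore] -/
theorem mfderiv_eq_of_hasFDerivAt_extChartAt {f : M → V} {x : M} {Φ : E → V} {L : E →L[ℝ] V}
    (hΦ : HasFDerivAt Φ L (extChartAt I x x)) (hf : f =ᶠ[𝓝 x] fun y ↦ Φ (extChartAt I x y))
    (v : TangentSpace I x) : mfderiv I 𝓘(ℝ, V) f x v = L v := by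
  have h1 : mfderiv I 𝓘(ℝ, V) f x = mfderiv I 𝓘(ℝ, V) (Φ ∘ extChartAt I x) x := hf.mfderiv_eq
  rw [h1]
  have hΦm : MDifferentiableAt 𝓘(ℝ, E) 𝓘(ℝ, V) Φ (extChartAt I x x) :=
    hΦ.differentiableAt.mdifferentiableAt
  have hφm : MDifferentiableAt I 𝓘(ℝ, E) (extChartAt I x) x :=
    mdifferentiableAt_extChartAt (mem_chart_source H x)
  rw [mfderiv_comp x hΦm hφm]
  change mfderiv 𝓘(ℝ, E) 𝓘(ℝ, V) Φ (extChartAt I x x) (mfderiv I 𝓘(ℝ, E) (extChartAt I x) x v) =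
    L v
  rw [mfderiv_extChartAt_self, mfderiv_eq_fderiv, hΦ.fderiv]
  rfl

/-- **The vector-valued manifold derivative through the extended chart**: under the hypotheses
of `mfderiv_eq_of_hasFDerivAt_extChartAt`, `mvfderiv I f x v = L v` (Mathlib's `mvfderiv` is
`mfderiv` followed by the canonical identification `T_{f x} V = V`). This generalises
`mvfderiv_eq_of_hasFDerivAt_chart` (manifolds modelled on the vector space itself) to an arbitrary
model with corners. [folklore] -/
theorem mvfderiv_eq_of_hasFDerivAt_extChartAt {f : M → V} {x : M} {Φ : E → V} {L : E →L[ℝ] V}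
    (hΦ : HasFDerivAt Φ L (extChartAt I x x)) (hf : f =ᶠ[𝓝 x] fun y ↦ Φ (extChartAt I x y))
    (v : TangentSpace I x) : mvfderiv I f x v = L v := by
  change ((NormedSpace.fromTangentSpace _).toContinuousLinearMap ∘L mfderiv I 𝓘(ℝ, V) f x) v =
    L v
  rw [ContinuousLinearMap.comp_apply, mfderiv_eq_of_hasFDerivAt_extChartAt hΦ hf v]
  rfl

end Chart

/-! ## §B. Families over a parameter manifold as smooth maps into `L²(K, μ)` -/

section Manifold

variable {EM : Type*} [NormedAddCommGroup EM] [NormedSpace ℝ EM] {HM : Type*} [TopologicalSpace HM]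
  {IM : ModelWithCorners ℝ EM HM} {M : Type*} [TopologicalSpace M] [ChartedSpace HM M]
  [IsManifold IM ∞ M] {EK : Type*} [NormedAddCommGroup EK] [NormedSpace ℝ EK] {HK : Type*}
  [TopologicalSpace HK] {IK : ModelWithCorners ℝ EK HK} {K : Type*} [TopologicalSpace K]
  [ChartedSpace HK K] {ρ : M → K → ℝ} {s : Set M}

/-- **The chart representative of a jointly smooth family is jointly smooth.** If
`(q, x) ↦ ρ q x` is `C^∞` on `s × K`, then for the extended chart `φ` of `M` at `p₀` the family
`(y, x) ↦ ρ (φ⁻¹ y) x` is `C^∞` on `(φ.target ∩ φ⁻¹⁻¹(s)) × K` (composition with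
`(y, x) ↦ (φ⁻¹ y, x)`, `contMDiffOn_extChartAt_symm`). [folklore] -/
theorem contMDiffOn_chartFamily_manifold (p₀ : M)
    (hρ : ContMDiffOn (IM.prod IK) 𝓘(ℝ, ℝ) ∞ (fun q : M × K ↦ ρ q.1 q.2) (s ×ˢ univ)) :
    ContMDiffOn (𝓘(ℝ, EM).prod IK) 𝓘(ℝ, ℝ) ∞
      (uncurry fun (y : EM) (x : K) ↦ ρ ((extChartAt IM p₀).symm y) x)
      (((extChartAt IM p₀).target ∩ (extChartAt IM p₀).symm ⁻¹' s) ×ˢ univ) :=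
  hρ.comp (f := fun q : EM × K ↦ ((extChartAt IM p₀).symm q.1, q.2))
    (((contMDiffOn_extChartAt_symm p₀).comp contMDiffOn_fst fun _ hq ↦ hq.1.1).prodMk
      contMDiffOn_snd) fun _ hq ↦ ⟨hq.1.2, mem_univ _⟩

omit [IsManifold IM ∞ M] in
/-- The chart point `φ p₀` lies in `φ.target ∩ φ⁻¹⁻¹(s)` when `p₀ ∈ s`. [folklore] -/
theorem extChartAt_mem_target_inter_preimage {p₀ : M} (hp₀ : p₀ ∈ s) :
    extChartAt IM p₀ p₀ ∈ (extChartAt IM p₀).target ∩ (extChartAt IM p₀).symm ⁻¹' s :=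
  ⟨mem_extChartAt_target p₀, by rwa [mem_preimage, extChartAt_to_inv]⟩

variable [IM.Boundaryless]

omit [IsManifold IM ∞ M] in
/-- For a boundaryless model, `φ.target ∩ φ⁻¹⁻¹(s)` is open for `s` open (`φ` an extended chart
of `M`; `φ.target` is open by `isOpen_extChartAt_target`). [folklore] -/
theorem isOpen_extChartAt_target_inter_preimage (p₀ : M) (hs : IsOpen s) :
    IsOpen ((extChartAt IM p₀).target ∩ (extChartAt IM p₀).symm ⁻¹' s) :=
  (continuousOn_extChartAt_symm p₀).isOpen_inter_preimage (isOpen_extChartAt_target p₀) hs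

/-- The chart representative of a family jointly smooth on `s × K` (`s` open) is jointly `C^∞`
at every point `(y, x)` with `y ∈ φ.target ∩ φ⁻¹⁻¹(s)` (an open set for a boundaryless model).
[folklore] -/
theorem contMDiffAt_chartFamily_manifold (hs : IsOpen s) (p₀ : M)
    (hρ : ContMDiffOn (IM.prod IK) 𝓘(ℝ, ℝ) ∞ (fun q : M × K ↦ ρ q.1 q.2) (s ×ˢ univ)) {y : EM}
    (hy : y ∈ (extChartAt IM p₀).target ∩ (extChartAt IM p₀).symm ⁻¹' s) (x : K) :
    ContMDiffAt (𝓘(ℝ, EM).prod IK) 𝓘(ℝ, ℝ) ∞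
      (uncurry fun (y : EM) (x : K) ↦ ρ ((extChartAt IM p₀).symm y) x) (y, x) :=
  (contMDiffOn_chartFamily_manifold p₀ hρ (y, x) ⟨hy, mem_univ _⟩).contMDiffAt
    (((isOpen_extChartAt_target_inter_preimage p₀ hs).prod isOpen_univ).mem_nhds
      ⟨hy, mem_univ _⟩)

end Manifold

/-- **A jointly smooth family over a parameter manifold is a smooth `L²`-valued map, with the
pointwise derivative** (helper of stub F `stub_instantonCollarPackage`). Let `M` be a `C^∞`
manifold over a boundaryless model with corners `IM` on a finite-dimensional space, `K` a compact
`C^∞` manifold with a finite Borel measure `μ`, `s ⊆ M` open, `ρ : M → K → ℝ` jointly `C^∞` on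
`s × K`, and `F p ∈ C(K, ℝ)` continuous representatives with `F p = ρ p` for `p ∈ s`. Then
(1) `p ↦ [F p] ∈ L²(K, μ)` is `C^∞` on `s` — in the extended chart `φ` at `p₀ ∈ s` it is
`y ↦ [F (φ⁻¹ y)]`, smooth on the open set `φ.target ∩ φ⁻¹⁻¹(s)` by `contDiffOn_toLp_family`
applied to the jointly smooth chart family `(y, x) ↦ ρ (φ⁻¹ y) x`; and (2) for `p ∈ s` and
`X ∈ T_p M`, the pointwise manifold derivative `x ↦ d(ρ · x)_p X` is continuous and its class is
the vector-valued manifold derivative `d(p ↦ [F p])_p X` — the chart representative has Fréchet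
derivative `X ↦ [x ↦ ∂_y ρ(φ⁻¹ y) x |_{φ p} X]` (`hasFDerivAt_toLp_family`), read back through the
chart by `mvfderiv_eq_of_hasFDerivAt_extChartAt`, and pointwise
`d(ρ · x)_p X = ∂_y ρ(φ⁻¹ y) x |_{φ p} X` by the same lemma with values in `ℝ`.
[cite: Dieudonne1960, (8.11.2)] -/
theorem helper_toLp_family_manifold
    {EM : Type*} [NormedAddCommGroup EM] [NormedSpace ℝ EM] [FiniteDimensional ℝ EM]
    {HM : Type*} [TopologicalSpace HM] {IM : ModelWithCorners ℝ EM HM} [IM.Boundaryless]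
    {M : Type*} [TopologicalSpace M] [ChartedSpace HM M] [IsManifold IM ∞ M]
    {EK : Type*} [NormedAddCommGroup EK] [NormedSpace ℝ EK] {HK : Type*} [TopologicalSpace HK]
    {IK : ModelWithCorners ℝ EK HK} {K : Type*} [TopologicalSpace K] [CompactSpace K]
    [ChartedSpace HK K] [IsManifold IK ∞ K] [MeasurableSpace K] [BorelSpace K]
    (μ : Measure K) [IsFiniteMeasure μ]
    {ρ : M → K → ℝ} {F : M → C(K, ℝ)} {s : Set M} (hs : IsOpen s)
    (hρ : ContMDiffOn (IM.prod IK) 𝓘(ℝ, ℝ) ∞ (fun q : M × K ↦ ρ q.1 q.2) (s ×ˢ univ))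
    (hF : ∀ p ∈ s, ∀ x, F p x = ρ p x) :
    ContMDiffOn IM 𝓘(ℝ, Lp ℝ 2 μ) ∞ (fun p ↦ ContinuousMap.toLp (E := ℝ) 2 μ ℝ (F p)) s ∧
    ∀ p ∈ s, ∀ X : TangentSpace IM p,
      ∃ hc : Continuous (fun x ↦ mfderiv IM 𝓘(ℝ, ℝ) (fun q ↦ ρ q x) p X),
        mvfderiv IM (fun p ↦ ContinuousMap.toLp (E := ℝ) 2 μ ℝ (F p)) p X =
          ContinuousMap.toLp (E := ℝ) 2 μ ℝ
            ⟨fun x ↦ mfderiv IM 𝓘(ℝ, ℝ) (fun q ↦ ρ q x) p X, hc⟩ := by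
  -- the chart data at a point `p₀ ∈ s`: the open set `U p₀ = φ.target ∩ φ⁻¹⁻¹(s)` containing
  -- `φ p₀`, on which the chart family is jointly smooth and `F ∘ φ⁻¹` represents it
  have hU : ∀ p₀ : M, IsOpen ((extChartAt IM p₀).target ∩ (extChartAt IM p₀).symm ⁻¹' s) :=
    fun p₀ ↦ isOpen_extChartAt_target_inter_preimage p₀ hs
  have hf : ∀ p₀ : M, ∀ y ∈ (extChartAt IM p₀).target ∩ (extChartAt IM p₀).symm ⁻¹' s, ∀ x,
      ContMDiffAt (𝓘(ℝ, EM).prod IK) 𝓘(ℝ, ℝ) ∞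
        (uncurry fun (y : EM) (x : K) ↦ ρ ((extChartAt IM p₀).symm y) x) (y, x) :=
    fun p₀ y hy x ↦ contMDiffAt_chartFamily_manifold hs p₀ hρ hy x
  have hF' : ∀ p₀ : M, ∀ y ∈ (extChartAt IM p₀).target ∩ (extChartAt IM p₀).symm ⁻¹' s, ∀ x,
      F ((extChartAt IM p₀).symm y) x = ρ ((extChartAt IM p₀).symm y) x :=
    fun p₀ y hy x ↦ hF _ hy.2 x
  -- the map agrees near `p₀` with its chart representative composed with the chart
  have hev : ∀ p₀ : M, (fun p ↦ ContinuousMap.toLp (E := ℝ) 2 μ ℝ (F p)) =ᶠ[𝓝 p₀] fun p ↦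
      ContinuousMap.toLp (E := ℝ) 2 μ ℝ (F ((extChartAt IM p₀).symm (extChartAt IM p₀ p))) := by
    intro p₀
    filter_upwards [extChartAt_source_mem_nhds (I := IM) p₀] with p hp
    rw [(extChartAt IM p₀).left_inv hp]
  refine ⟨fun p₀ hp₀ ↦ ?_, fun p hp X ↦ ?_⟩
  · -- (1) smoothness at `p₀ ∈ s`
    have h := contDiffOn_toLp_family (ν := μ) (hU p₀) (hf p₀) (hF' p₀)
    have hat : ContMDiffAt IM 𝓘(ℝ, Lp ℝ 2 μ) ∞ (fun p ↦ ContinuousMap.toLp (E := ℝ) 2 μ ℝ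
        (F ((extChartAt IM p₀).symm (extChartAt IM p₀ p)))) p₀ :=
      (h.contDiffAt ((hU p₀).mem_nhds
        (extChartAt_mem_target_inter_preimage hp₀))).contMDiffAt.comp p₀ contMDiffAt_extChartAt
    exact (hat.congr_of_eventuallyEq (hev p₀)).contMDiffWithinAt
  · -- (2) the derivative at `p ∈ s` along `X`
    have hpU := extChartAt_mem_target_inter_preimage (IM := IM) hp
    obtain ⟨L, hL, hFL⟩ := hasFDerivAt_toLp_family (ν := μ)
      (F := fun y ↦ F ((extChartAt IM p).symm y))
      (eventually_of_mem ((hU p).mem_nhds hpU) (hf p))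
      (eventually_of_mem ((hU p).mem_nhds hpU) (hF' p))
    -- the pointwise manifold derivative is the chart derivative `L X x`
    have hpt : ∀ x, mfderiv IM 𝓘(ℝ, ℝ) (fun q ↦ ρ q x) p X = L X x := by
      intro x
      rw [hL]
      have hd : HasFDerivAt (fun y ↦ ρ ((extChartAt IM p).symm y) x)
          (fderiv ℝ (fun y ↦ ρ ((extChartAt IM p).symm y) x) (extChartAt IM p p))
          (extChartAt IM p p) :=
        ((contDiffAt_family_apply (hf p _ hpU x)).differentiableAt (by simp)).hasFDerivAt
      have hevx : (fun q ↦ ρ q x) =ᶠ[𝓝 p]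
          fun q ↦ ρ ((extChartAt IM p).symm (extChartAt IM p q)) x := by
        filter_upwards [extChartAt_source_mem_nhds (I := IM) p] with q hq
        rw [(extChartAt IM p).left_inv hq]
      exact mfderiv_eq_of_hasFDerivAt_extChartAt hd hevx X
    have hc : Continuous fun x ↦ mfderiv IM 𝓘(ℝ, ℝ) (fun q ↦ ρ q x) p X := by
      have e : (fun x ↦ mfderiv IM 𝓘(ℝ, ℝ) (fun q ↦ ρ q x) p X) = L X := funext hpt
      rw [e]
      exact (L X).continuous
    refine ⟨hc, ?_⟩
    rw [mvfderiv_eq_of_hasFDerivAt_extChartAt hFL (hev p) X, ContinuousLinearMap.comp_apply]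
    congr 1
    ext x
    exact (hpt x).symm

end Summit.SmoothPoincare4.SmoothPoincare4.Cruxes.AhHadamardFilling.FisherSphereGauss

end
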